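/-
Fleet lead `ym-wcr-19609-p1` (seat prover-ym-wcr-19609-p1-g2-0), route `WeakCouplingRates`, crux `BulkDominatesColdBoxW`
(stmt-QuantumFields-19609), line `dlr-chessboard` (v6): observable TRANSPORT `ω ↔ ω^g ↔ truncated gauge copy` for the assembly (H-A1).
-/
import Summits.QuantumFields.YangMills.Theorems.WeakCouplingRatesBulkDominatesColdBoxWKernelCongrCollar
import Summits.QuantumFields.YangMills.Theorems.WeakCouplingRatesBulkDominatesColdBoxWKernelGauge
import Summits.QuantumFields.YangMills.Theorems.WeakCouplingRatesBulkDominatesColdBoxWLinearisedDatumEnergy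
import Summits.QuantumFields.YangMills.Theorems.WeakCouplingRatesColdBoxDirichletForm
import Summits.QuantumFields.YangMills.Theorems.WeakCouplingRatesColdBoxLargeFieldSU2

/-!
# Crux `BulkDominatesColdBoxW`: the box kernel's means of box-local gauge-invariant observables are unchanged when the datum is replaced by its
# TRUNCATED GAUGE COPY (the configuration charted in `…DatumCompetitor`)

For the assembly of `KernelMeanExpansion` / `KernelCovExpansion` (critic's STUB-PLAN H-A1, evidence #30): the interface speaks of `boxKernel β H ω`
for the crude-good `ω`, the representation is written for the truncated gauge copy `ω₂ = glueWith E ((ω^g)|_E) 1`, `E = boxEdgesAt dirCorner (2H+3)`.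
For every measurable, gauge-invariant observable `F` that reads only the links of the cold box `Λ` (`F (glueWith Λ ζ η)` independent of `η`),
`∫ F d(boxKernel β H ω) = ∫ F d(boxKernel β H ω₂)` (`integral_boxKernel_eq_trunc_gauge`): gauge covariance of the kernel (B3
`integral_ymSpecification_gaugeTransformZd`) and the collar congruence (`integral_ymSpecification_congr_collar`; every edge of a plaquette touching
`Λ` lies in `E`, `plaquetteEdges_subset_enlarged`).  Instances: one plaquette cost and the product of two plaquette costs based in the box
(`integral_plaqCostAt_boxKernel_eq_trunc_gauge`, `integral_plaqCostAt_mul_boxKernel_eq_trunc_gauge`).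
No new definition; standard axioms.  NOT a claim about the mass gap.
-/

set_option autoImplicit false

noncomputable section

open MeasureTheory Finset
open Literature.Probability.LatticeModels Literature.MathematicalPhysics.QuantumLattice
open Literature.MathematicalPhysics.QuantumFieldTheory Literature.MathematicalPhysics.QuantumFieldTheory.AxialGauge
open Literature.MathematicalPhysics.QuantumFieldTheory.LatticeMaxwell

namespace Summit.QuantumFields.YangMills.Theorems.WeakCouplingRates

variable {H : ℕ}

/-- **Every edge of a plaquette touching the cold box lies in the enlarged box** `E = boxEdgesAt dirCorner (2H+3)`. -/
theorem plaquetteEdges_subset_enlarged {p : ZdPlaquette 4} (hp : p ∈ plaquettesTouching (boxEdges 4 (2 * H + 1)))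
    {e : Literature.MathematicalPhysics.QuantumLattice.ZdEdge 4} (he : e ∈ plaquetteEdges p) : e ∈ boxEdgesAt dirCorner (2 * H + 3) := by
  have hq := unshift_mem_plaquettesIn hp
  obtain ⟨e1, e2, e3, e4⟩ := shift_edges_mem_boxEdgesAt (a := dirCorner) hq
  have hs : Plaq.shift dirCorner ((p.1 - dirCorner, p.2.1.1, p.2.1.2) : Plaq 4) = (p.1, p.2.1.1, p.2.1.2) := by
    simp [Plaq.shift]
  rw [hs] at e1 e2 e3 e4
  simp only [plaquetteEdges, mem_insert, mem_singleton] at he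
  rcases he with rfl | rfl | rfl | rfl
  · exact e1
  · exact e2
  · exact e3
  · exact e4

/-- **Kernel means of box-local gauge-invariant observables are unchanged under `ω ↦` truncated gauge copy.** -/
theorem integral_boxKernel_eq_trunc_gauge (β : ℝ) (H : ℕ) (ω : LGConfig 4 (Matrix.specialUnitaryGroup (Fin 2) ℂ))
    (g : Site 4 → Matrix.specialUnitaryGroup (Fin 2) ℂ) {F : LGConfig 4 (Matrix.specialUnitaryGroup (Fin 2) ℂ) → ℝ}
    (hF : Measurable F) (hFinv : IsZdGaugeInvariant F)
    (hFloc : ∀ (ζ : ↥(boxEdges 4 (2 * H + 1)) → Matrix.specialUnitaryGroup (Fin 2) ℂ) (η η' : LGConfig 4 (Matrix.specialUnitaryGroup (Fin 2) ℂ)),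
      F (glueWith (boxEdges 4 (2 * H + 1)) ζ η) = F (glueWith (boxEdges 4 (2 * H + 1)) ζ η')) :
    ∫ U, F U ∂(boxKernel β H ω) =
      ∫ U, F U ∂(boxKernel β H (glueWith (boxEdgesAt dirCorner (2 * H + 3))
        (fun e' : ↥(boxEdgesAt dirCorner (2 * H + 3)) => gaugeTransformZd g ω e'.1) (fun _ => 1))) := by
  unfold boxKernel
  rw [← integral_ymSpecification_gaugeTransformZd (fundamentalRep (Fin 2)) (continuous_fundamentalRep (Fin 2)) β _ hF hFinv g ω]
  refine integral_ymSpecification_congr_collar (fundamentalRep (Fin 2)) (continuous_fundamentalRep (Fin 2)) β _ ?_ hF ?_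
  · intro p hp e he _
    rw [glueWith_apply_mem _ _ _ (plaquetteEdges_subset_enlarged hp he)]
  · intro ζ; exact hFloc ζ _ _

/-- The glued configuration on a box edge is the interior value, whatever the datum. -/
theorem glueWith_box_apply_mem {G : Type*} (ζ : ↥(boxEdges 4 (2 * H + 1)) → G) (η : LGConfig 4 G)
    {e : Literature.MathematicalPhysics.QuantumLattice.ZdEdge 4} (he : e ∈ boxEdges 4 (2 * H + 1)) :
    glueWith (boxEdges 4 (2 * H + 1)) ζ η e = ζ ⟨e, he⟩ := glueWith_apply_mem _ _ _ he

/-- A plaquette cost whose four edges are box edges reads the glued configuration independently of the datum. -/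
theorem plaqCostAt_glueWith_eq {G : Type*} [Group G] {N : ℕ} (ρ : G →* Matrix (Fin N) (Fin N) ℂ) {x : Site 4} {i j : Fin 4}
    (h1 : (x, i) ∈ boxEdges 4 (2 * H + 1)) (h2 : (x + Pi.single i 1, j) ∈ boxEdges 4 (2 * H + 1))
    (h3 : (x + Pi.single j 1, i) ∈ boxEdges 4 (2 * H + 1)) (h4 : (x, j) ∈ boxEdges 4 (2 * H + 1))
    (ζ : ↥(boxEdges 4 (2 * H + 1)) → G) (η η' : LGConfig 4 G) :
    plaqCostAt ρ x i j (glueWith (boxEdges 4 (2 * H + 1)) ζ η) = plaqCostAt ρ x i j (glueWith (boxEdges 4 (2 * H + 1)) ζ η') :=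
  plaqCostAt_congr ρ x i j
    (by rw [glueWith_apply_mem _ _ _ h1, glueWith_apply_mem _ _ _ h1])
    (by rw [glueWith_apply_mem _ _ _ h2, glueWith_apply_mem _ _ _ h2])
    (by rw [glueWith_apply_mem _ _ _ h3, glueWith_apply_mem _ _ _ h3])
    (by rw [glueWith_apply_mem _ _ _ h4, glueWith_apply_mem _ _ _ h4])

/-- **Transport of one plaquette mean**: for a plaquette whose four edges are box edges,
`E_{boxKernel β H ω}[c_p] = E_{boxKernel β H ω₂}[c_p]`, `ω₂` the truncated gauge copy. -/
theorem integral_plaqCostAt_boxKernel_eq_trunc_gauge (β : ℝ) (H : ℕ) (ω : LGConfig 4 (Matrix.specialUnitaryGroup (Fin 2) ℂ))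
    (g : Site 4 → Matrix.specialUnitaryGroup (Fin 2) ℂ) {x : Site 4} {i j : Fin 4}
    (h1 : (x, i) ∈ boxEdges 4 (2 * H + 1)) (h2 : (x + Pi.single i 1, j) ∈ boxEdges 4 (2 * H + 1))
    (h3 : (x + Pi.single j 1, i) ∈ boxEdges 4 (2 * H + 1)) (h4 : (x, j) ∈ boxEdges 4 (2 * H + 1)) :
    ∫ U, plaqCostAt (fundamentalRep (Fin 2)) x i j U ∂(boxKernel β H ω) =
      ∫ U, plaqCostAt (fundamentalRep (Fin 2)) x i j U ∂(boxKernel β H (glueWith (boxEdgesAt dirCorner (2 * H + 3))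
        (fun e' : ↥(boxEdgesAt dirCorner (2 * H + 3)) => gaugeTransformZd g ω e'.1) (fun _ => 1))) :=
  integral_boxKernel_eq_trunc_gauge β H ω g (measurable_plaqCostAt x i j) (isZdGaugeInvariant_plaqCostAt _ x i j)
    (fun ζ η η' => plaqCostAt_glueWith_eq (fundamentalRep (Fin 2)) h1 h2 h3 h4 ζ η η')

/-- **Transport of the product of two plaquette costs** (both plaquettes with their four edges in the box). -/
theorem integral_plaqCostAt_mul_boxKernel_eq_trunc_gauge (β : ℝ) (H : ℕ) (ω : LGConfig 4 (Matrix.specialUnitaryGroup (Fin 2) ℂ))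
    (g : Site 4 → Matrix.specialUnitaryGroup (Fin 2) ℂ) {x y : Site 4} {i j k l : Fin 4}
    (h1 : (x, i) ∈ boxEdges 4 (2 * H + 1)) (h2 : (x + Pi.single i 1, j) ∈ boxEdges 4 (2 * H + 1))
    (h3 : (x + Pi.single j 1, i) ∈ boxEdges 4 (2 * H + 1)) (h4 : (x, j) ∈ boxEdges 4 (2 * H + 1))
    (h1' : (y, k) ∈ boxEdges 4 (2 * H + 1)) (h2' : (y + Pi.single k 1, l) ∈ boxEdges 4 (2 * H + 1))
    (h3' : (y + Pi.single l 1, k) ∈ boxEdges 4 (2 * H + 1)) (h4' : (y, l) ∈ boxEdges 4 (2 * H + 1)) :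
    ∫ U, plaqCostAt (fundamentalRep (Fin 2)) x i j U * plaqCostAt (fundamentalRep (Fin 2)) y k l U ∂(boxKernel β H ω) =
      ∫ U, plaqCostAt (fundamentalRep (Fin 2)) x i j U * plaqCostAt (fundamentalRep (Fin 2)) y k l U
        ∂(boxKernel β H (glueWith (boxEdgesAt dirCorner (2 * H + 3))
          (fun e' : ↥(boxEdgesAt dirCorner (2 * H + 3)) => gaugeTransformZd g ω e'.1) (fun _ => 1))) :=
  integral_boxKernel_eq_trunc_gauge β H ω g ((measurable_plaqCostAt x i j).mul (measurable_plaqCostAt y k l))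
    (isZdGaugeInvariant_plaqCostAt_mul _ x y i j k l)
    (fun ζ η η' => by
      rw [plaqCostAt_glueWith_eq (fundamentalRep (Fin 2)) h1 h2 h3 h4 ζ η η',
        plaqCostAt_glueWith_eq (fundamentalRep (Fin 2)) h1' h2' h3' h4' ζ η η'])

/-! ## Observables that read the ENLARGED box (e.g. the large-field event of the collar): weak locality suffices -/

/-- **Transport under weak locality**: it suffices that `F (glueWith Λ ζ η)` depends on `η` only through its links in the enlarged box `E`
(e.g. observables of the plaquettes touching `Λ`). -/
theorem integral_boxKernel_eq_trunc_gauge_of_enlarged (β : ℝ) (H : ℕ) (ω : LGConfig 4 (Matrix.specialUnitaryGroup (Fin 2) ℂ))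
    (g : Site 4 → Matrix.specialUnitaryGroup (Fin 2) ℂ) {F : LGConfig 4 (Matrix.specialUnitaryGroup (Fin 2) ℂ) → ℝ}
    (hF : Measurable F) (hFinv : IsZdGaugeInvariant F)
    (hFloc : ∀ (ζ : ↥(boxEdges 4 (2 * H + 1)) → Matrix.specialUnitaryGroup (Fin 2) ℂ) (η η' : LGConfig 4 (Matrix.specialUnitaryGroup (Fin 2) ℂ)),
      (∀ e ∈ boxEdgesAt dirCorner (2 * H + 3), η e = η' e) →
        F (glueWith (boxEdges 4 (2 * H + 1)) ζ η) = F (glueWith (boxEdges 4 (2 * H + 1)) ζ η')) :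
    ∫ U, F U ∂(boxKernel β H ω) =
      ∫ U, F U ∂(boxKernel β H (glueWith (boxEdgesAt dirCorner (2 * H + 3))
        (fun e' : ↥(boxEdgesAt dirCorner (2 * H + 3)) => gaugeTransformZd g ω e'.1) (fun _ => 1))) := by
  unfold boxKernel
  rw [← integral_ymSpecification_gaugeTransformZd (fundamentalRep (Fin 2)) (continuous_fundamentalRep (Fin 2)) β _ hF hFinv g ω]
  have hagree : ∀ e ∈ boxEdgesAt dirCorner (2 * H + 3), gaugeTransformZd g ω e =
      glueWith (boxEdgesAt dirCorner (2 * H + 3))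
        (fun e' : ↥(boxEdgesAt dirCorner (2 * H + 3)) => gaugeTransformZd g ω e'.1) (fun _ => 1) e := fun e he => by
    rw [glueWith_apply_mem _ _ _ he]
  refine integral_ymSpecification_congr_collar (fundamentalRep (Fin 2)) (continuous_fundamentalRep (Fin 2)) β _ ?_ hF ?_
  · intro p hp e he _
    exact hagree e (plaquetteEdges_subset_enlarged hp he)
  · intro ζ; exact hFloc ζ _ _ hagree

/-- **Transport of probabilities of gauge-invariant events reading the enlarged box.** -/
theorem measureReal_boxKernel_eq_trunc_gauge_of_enlarged (β : ℝ) (H : ℕ) (ω : LGConfig 4 (Matrix.specialUnitaryGroup (Fin 2) ℂ))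
    (g : Site 4 → Matrix.specialUnitaryGroup (Fin 2) ℂ) {s : Set (LGConfig 4 (Matrix.specialUnitaryGroup (Fin 2) ℂ))}
    (hs : MeasurableSet s) (hsinv : ∀ (g' : Site 4 → Matrix.specialUnitaryGroup (Fin 2) ℂ) U, gaugeTransformZd g' U ∈ s ↔ U ∈ s)
    (hsloc : ∀ (ζ : ↥(boxEdges 4 (2 * H + 1)) → Matrix.specialUnitaryGroup (Fin 2) ℂ) (η η' : LGConfig 4 (Matrix.specialUnitaryGroup (Fin 2) ℂ)),
      (∀ e ∈ boxEdgesAt dirCorner (2 * H + 3), η e = η' e) →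
        (glueWith (boxEdges 4 (2 * H + 1)) ζ η ∈ s ↔ glueWith (boxEdges 4 (2 * H + 1)) ζ η' ∈ s)) :
    (boxKernel β H ω).real s =
      (boxKernel β H (glueWith (boxEdgesAt dirCorner (2 * H + 3))
        (fun e' : ↥(boxEdgesAt dirCorner (2 * H + 3)) => gaugeTransformZd g ω e'.1) (fun _ => 1))).real s := by
  rw [← integral_indicator_one hs, ← integral_indicator_one hs]
  refine integral_boxKernel_eq_trunc_gauge_of_enlarged β H ω g (measurable_const.indicator hs) ?_ ?_
  · intro g' U
    by_cases hU : U ∈ s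
    · rw [Set.indicator_of_mem hU, Set.indicator_of_mem ((hsinv g' U).2 hU)]; rfl
    · rw [Set.indicator_of_notMem hU, Set.indicator_of_notMem (fun h => hU ((hsinv g' U).1 h))]
  · intro ζ η η' hη
    by_cases hU : glueWith (boxEdges 4 (2 * H + 1)) ζ η ∈ s
    · rw [Set.indicator_of_mem hU, Set.indicator_of_mem ((hsloc ζ η η' hη).1 hU)]; rfl
    · rw [Set.indicator_of_notMem hU, Set.indicator_of_notMem (fun h => hU ((hsloc ζ η η' hη).2 h))]

/-- The plaquette observable only reads the four links of the plaquette. -/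
theorem plaquetteObs_congr_links {G : Type*} [Group G] {N : ℕ} (ρ : G →* Matrix (Fin N) (Fin N) ℂ) (x : Site 4) (i j : Fin 4)
    {U U' : LGConfig 4 G} (h1 : U (x, i) = U' (x, i)) (h2 : U (x + Pi.single i 1, j) = U' (x + Pi.single i 1, j))
    (h3 : U (x + Pi.single j 1, i) = U' (x + Pi.single j 1, i)) (h4 : U (x, j) = U' (x, j)) :
    plaquetteObs ρ x i j U = plaquetteObs ρ x i j U' := by
  simp only [plaquetteObs, plaquetteHolonomyZd, h1, h2, h3, h4]

/-- **The large-field event of the collar has the same kernel probability at `ω` and at its truncated gauge copy** — so the YM-side rarity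
`boxKernel_largeField_rarity_crudeGood` (stated for crude-good `ω`) transfers to the charted configuration of the assembly. -/
theorem measureReal_largeField_boxKernel_eq_trunc_gauge (β s : ℝ) (H : ℕ) (ω : LGConfig 4 (Matrix.specialUnitaryGroup (Fin 2) ℂ))
    (g : Site 4 → Matrix.specialUnitaryGroup (Fin 2) ℂ) :
    (boxKernel β H ω).real {U | ∃ p ∈ plaquettesTouching (boxEdges 4 (2 * H + 1)),
        s ≤ (2 : ℝ) - plaquetteObs (fundamentalRep (Fin 2)) p.1 p.2.1.1 p.2.1.2 U} =
      (boxKernel β H (glueWith (boxEdgesAt dirCorner (2 * H + 3))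
        (fun e' : ↥(boxEdgesAt dirCorner (2 * H + 3)) => gaugeTransformZd g ω e'.1) (fun _ => 1))).real
        {U | ∃ p ∈ plaquettesTouching (boxEdges 4 (2 * H + 1)),
          s ≤ (2 : ℝ) - plaquetteObs (fundamentalRep (Fin 2)) p.1 p.2.1.1 p.2.1.2 U} := by
  refine measureReal_boxKernel_eq_trunc_gauge_of_enlarged β H ω g (measurableSet_exists_plaqCost_ge _ s) ?_ ?_
  · intro g' U
    simp only [Set.mem_setOf_eq, isZdGaugeInvariant_plaquetteObs (fundamentalRep (Fin 2)) _ _ _ g' U]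
  · intro ζ η η' hη
    have hkey : ∀ p ∈ plaquettesTouching (boxEdges 4 (2 * H + 1)),
        plaquetteObs (fundamentalRep (Fin 2)) p.1 p.2.1.1 p.2.1.2 (glueWith (boxEdges 4 (2 * H + 1)) ζ η) =
          plaquetteObs (fundamentalRep (Fin 2)) p.1 p.2.1.1 p.2.1.2 (glueWith (boxEdges 4 (2 * H + 1)) ζ η') := by
      intro p hp
      have hlink : ∀ e ∈ plaquetteEdges p, glueWith (boxEdges 4 (2 * H + 1)) ζ η e = glueWith (boxEdges 4 (2 * H + 1)) ζ η' e := by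
        intro e he
        by_cases heΛ : e ∈ boxEdges 4 (2 * H + 1)
        · rw [glueWith_apply_mem _ _ _ heΛ, glueWith_apply_mem _ _ _ heΛ]
        · rw [glueWith_apply_not_mem _ _ _ heΛ, glueWith_apply_not_mem _ _ _ heΛ, hη e (plaquetteEdges_subset_enlarged hp he)]
      refine plaquetteObs_congr_links (fundamentalRep (Fin 2)) p.1 p.2.1.1 p.2.1.2 ?_ ?_ ?_ ?_ <;> apply hlink <;>
        simp [plaquetteEdges]
    simp only [Set.mem_setOf_eq]
    constructor
    · rintro ⟨p, hp, h⟩; exact ⟨p, hp, by rwa [← hkey p hp]⟩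
    · rintro ⟨p, hp, h⟩; exact ⟨p, hp, by rwa [hkey p hp]⟩

end Summit.QuantumFields.YangMills.Theorems.WeakCouplingRates

end
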